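import Summits.CriticalPhenomena.CardyFormulaZ2.Theses.CardyMagicRigidity
import Literature.Probability.Percolation.ChayesLeiHex
import Literature.Probability.Percolation.FullPlaneCNL
import Literature.Probability.Percolation.LoopRepresentationProofs
import Literature.Probability.Percolation.QuadCrossingSpace

/-!
# Sketch — crux-ideate stmt-CriticalPhenomena-4833 (LoopLimitZ2EqT), ideator 3, round 1

First lemmas of the two idea cards, typed over existing declarations, plus the (provable-now)
d_CN triangle glue showing how a coupling CHAIN concludes the crux by name.
-/

noncomputable section

open MeasureTheory Filter Set
open scoped ENNReal NNReal Topology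

namespace Summit.CriticalPhenomena.CardyFormulaZ2.Cruxes.LoopLimitZ2EqT.Sketch

open Literature.Probability.Percolation Literature.Probability.LatticeModels
open Literature.Probability.RandomPlanarGeometry

/-! ## Card A (lozenge-chayes-lei-chain): first lemma -/

/-- **SegmentBoxCrossing** (first lemma of card A): uniform box-crossing (RSW) along the
self-dual, positively correlated Chayes–Lei segment — for every hexagon model `M = (a, e, s)` with
`a = e` (self-dual, critical) and `2s² ≤ ae` (FKG), the probability of a YELLOW (primal)
crossing of the lattice parallelogram `{0 ≤ x₀ ≤ 2n, 0 ≤ x₁ ≤ n}` of `𝕋` between its short sides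
(hard way) is at least `c > 0`, uniformly in `n ≥ 1` and in `M` on the segment.  Technology:
Köhler-Schindler–Tassion RSW (positive association + symmetries + self-duality) or
Bollobás–Riordan; `s = 0` is site percolation on `𝕋`, `M = triBondCritical` is critical bond-`𝕋`. -/
def SegmentBoxCrossing : Prop :=
  ∃ c : ℝ, 0 < c ∧ ∀ M : ChayesLeiHexPercolation, M.IsSelfDual → M.PosCorrCond →
    ∀ n : ℕ, 1 ≤ n →
      ENNReal.ofReal c ≤ clHexPercolation M {σ : CLHexConfig | ∃ x y : Site 2,
        x 0 = 0 ∧ y 0 = 2 * (n : ℤ) ∧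
        ∃ w : (clYellowGraph σ).Walk x y, ∀ z ∈ w.support,
          0 ≤ z 0 ∧ z 0 ≤ 2 * (n : ℤ) ∧ 0 ≤ z 1 ∧ z 1 ≤ (n : ℤ)}

/-- Measurability of the exceptional event of the (bond-`ℤ²`, site-`𝕋`) pair — verbatim the standing
disprover's `Disproof.measurableSet_isClose_bond_site` (Disproof.lean §0; inlined here only because
that module is not yet built on the farm): both loop representations are countably generated by
measurable "`γ` is an interface loop of type `i`" events. -/
theorem measurableSet_isClose_bond_site (δ α δ' ε : ℝ) :
    MeasurableSet {p : BondConfig (Site 2) × SiteConfig (Site 2) |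
      LoopConfig.IsClose ε (bondLoopConfig δ α p.1) (siteLoopConfig δ' p.2)} := by
  haveI := countable_sigma_hexLoop
  exact LoopConfig.measurableSet_isClose_of_gen
    (fun i (k : {γ : List MedialVertex // γ ≠ []}) ↦ measurableSet_setOf_isInterfaceLoop_and k.1 i)
    (gen_bondLoopConfig δ α) (measurableSet_gen_siteLoopConfig) (gen_siteLoopConfig δ') ε

/-- **ChainGlue** (PROVED; the shape by which card A's coupling chain concludes the crux BY NAME):
any intermediate family of random loop configurations `Y δ` (e.g. the typed loop ensemble of critical
bond percolation on `δ𝕋`, or of the Chayes–Lei model `(a_s | s,s,s | a_s)`) that is `d_CN`-asymptotic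
to bond-`ℤ²` on one side and to site-`𝕋` on the other gives `LoopLimitZ2EqT`, by
`cnLawEDist_triangle` (gluing of couplings) and `0 + 0 = 0`. The measurability side condition of the
gluing is the standing disprover's `Disproof.measurableSet_isClose_bond_site` (Disproof.lean §0), so
NO hypothesis on `Y` or on its probability space remains. (Mesh mismatch: if leg 1 lands on bond-`ℤ²`
at mesh `r δ`, insert the `d_CN`-Cauchy bound `Disproof.cnLawEDist_bond_bond_le` / Camia–Newman
uniqueness; kept in prose.) -/
theorem chainGlue {Ω : Type*} [MeasurableSpace Ω] (ν : Measure Ω) [IsProbabilityMeasure ν]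
    (Y : ℝ → Ω → LoopConfig ℂ)
    (h₁ : Tendsto (fun δ : ℝ ↦ LoopConfig.cnLawEDist (bondPercolation (zdGraph 2) half)
      (bondLoopConfig δ 0) ν (Y δ)) (𝓝[>] 0) (𝓝 0))
    (h₂ : Tendsto (fun δ : ℝ ↦ LoopConfig.cnLawEDist ν (Y δ) (triSitePercolation half)
      (siteLoopConfig δ)) (𝓝[>] 0) (𝓝 0)) :
    Theses.CardyMagicRigidity.LoopLimitZ2EqT := by
  haveI := standardBorelSpace_bondConfig
  haveI := standardBorelSpace_siteConfig
  show Tendsto (fun δ : ℝ ↦ LoopConfig.cnLawEDist (bondPercolation (zdGraph 2) half)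
      (bondLoopConfig δ 0) (triSitePercolation half) (siteLoopConfig δ)) (𝓝[>] 0) (𝓝 0)
  have hle : ∀ δ : ℝ, LoopConfig.cnLawEDist (bondPercolation (zdGraph 2) half)
      (bondLoopConfig δ 0) (triSitePercolation half) (siteLoopConfig δ) ≤
      LoopConfig.cnLawEDist (bondPercolation (zdGraph 2) half) (bondLoopConfig δ 0) ν (Y δ) +
      LoopConfig.cnLawEDist ν (Y δ) (triSitePercolation half) (siteLoopConfig δ) :=
    fun δ ↦ LoopConfig.cnLawEDist_triangle _ _ _ _ _ _
      (measurableSet_isClose_bond_site δ 0 δ)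
  have hlim := h₁.add h₂
  simp only [add_zero] at hlim
  exact tendsto_of_tendsto_of_tendsto_of_le_of_le tendsto_const_nhds hlim (fun _ ↦ bot_le) hle

/-! ## Card B (noise-rigidity-loop-level): first lemma -/

/-- **ContinuumDichotomy** (first lemma of card B, provable with the tree's quad-crossing
continuity estimates): the set `Λ` of subsequential Schramm–Smirnov quad-crossing limits of
critical bond percolation on `ℤ²` (whole plane) is the cluster set of an asymptotically
continuous path in a compact metrizable space, hence a continuum: either a single law (then
LimitExists and exact dilation invariance of the limit come for free) or uncountably many
pairwise distinct laws (each an E(2)-invariant, exactly self-dual planar black noise). -/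
def ContinuumDichotomy : Prop :=
  (QuadCrossing.subseqQuadLimits (Set.univ : Set ℂ)).Subsingleton ∨
    ¬ (QuadCrossing.subseqQuadLimits (Set.univ : Set ℂ)).Countable

end Summit.CriticalPhenomena.CardyFormulaZ2.Cruxes.LoopLimitZ2EqT.Sketch

end
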